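import Summits.QuantumFields.BalabanUV.T4Continuum.Support.NE7LawLevelAssembly

/-!
# NE7, ROAD P4 (law-level), leaf (k4): EXISTENCE OF THE CONDITIONAL DRESSING MEANS (NODE Q.0) from a realisation of
# the two laws on ONE probability space — Doob–Dynkin + conditional expectation, abstract; and `DressingMeans` by name

(Cell `pub-balaban`, sub-cell `t4`, binder row NE7 = node U5, co-owner #4 `b2b-balaban-t4-ne7-p4`; skeleton
`HOME/t4/skeletons/NE7-t4-ne7-p4.md` §2 NODE Q, leaf Q.0 = swarm item (k4).  Files of the road: `NE7LawLevelSocket` p206810,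
`NE7LawLevelAssembly` p207170, `NE7LawLevelTilt` p207299.)

HONEST FRAMING (T4-DAG PAGE 1).  Rung (B)+1 on ONE FIXED finite four-torus, CONDITIONAL on `BetaPertH` and the nine
spine estimates (0/9 proved); NOT infinite volume, NOT a mass gap, NOT the Clay problem.  NE7 is NOT PRINTED and NOT
proved here.  This file is pure [folklore] measure theory (Mathlib's conditional expectation + the Doob–Dynkin
factorisation `StronglyMeasurable.exists_eq_measurable_comp`), sorry-free; it discharges the EXISTENCE half of NODE Q
of the road (the shape `DressingMeans S ν m`) from a CHAIN REALISATION — per `K`, ONE probability space carrying a copy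
`ι K` of run `K`'s Gibbs field and the chain's endpoint `Y K` with law `ν K` —, which is what Bałaban's
averaging-and-resampling chain provides once constructed (mass preservation of `ℝ`, [Balaban1989LargeFieldI] (0.4)
p. 176, quoted in `T4PathwiseCoupling`'s header; the chain's CONSTRUCTION for Bałaban's kernels is NODE O / [dict]).
No estimate; NOT summit progress.

WHAT IS PROVED.
* `exists_condMean_factor` : on a probability space, a measurable `|F| ≤ 1` has a conditional mean given a measurable
  map `Y` that FACTORS as a measurable `m : X → [−1, 1]` through `Y`, with `∫_{Y⁻¹A} F = ∫_A m d(Y_*P)` for every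
  measurable `A` and `∫ F = ∫ m d(Y_*P)`.
* `exists_dressingMeans_of_realisation` : a chain realisation of the scheme's Gibbs fields and of the laws `ν K` gives
  `∃ m, DressingMeans S ν m` (the binder `hm` of `hasContinuumLimit_of_leaves`).
-/

noncomputable section

open MeasureTheory

namespace Summit.QuantumFields.BalabanUV.T4Continuum.NE7LawLevel

open Literature.MathematicalPhysics.QuantumFieldTheory.Balaban1983to89
open T4VarianceMatching Missing

/-! ## §1 Abstract: the conditional mean factors through the conditioning map (Doob–Dynkin) -/

section CondMean

variable {Ω X : Type*} [mΩ : MeasurableSpace Ω] [mX : MeasurableSpace X]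

/-- **Leaf (k4), abstract half.**  Let `P` be a probability measure on `Ω`, `Y : Ω → X` measurable, `F : Ω → ℝ`
measurable with `|F| ≤ 1`.  Then there is a measurable `m : X → ℝ` with `|m| ≤ 1` EVERYWHERE such that
`∫_{Y⁻¹ A} F dP = ∫_A m d(P.map Y)` for every measurable `A ⊆ X`, and `∫ F dP = ∫ m d(P.map Y)`.  (`m` = a clamped
Doob–Dynkin factor of the conditional expectation `P[F | σ(Y)]`.) [folklore] -/
theorem exists_condMean_factor (P : Measure Ω) [IsProbabilityMeasure P] {Y : Ω → X} (hY : Measurable Y)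
    {F : Ω → ℝ} (hFm : Measurable F) (hFb : ∀ ω, |F ω| ≤ 1) :
    ∃ m : X → ℝ, Measurable m ∧ (∀ x, |m x| ≤ 1) ∧
      (∀ A : Set X, MeasurableSet A → ∫ ω in Y ⁻¹' A, F ω ∂P = ∫ x in A, m x ∂(P.map Y)) ∧
      ∫ ω, F ω ∂P = ∫ x, m x ∂(P.map Y) := by
  -- the σ-algebra generated by `Y` is `mX.comap Y` (written out everywhere: no local instance is introduced)
  have hle : mX.comap Y ≤ mΩ := hY.comap_le
  have hFi : Integrable F P := integrable_of_abs_le P hFm (B := 1) hFb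
  -- the conditional expectation and its Doob–Dynkin factor
  have hsm : StronglyMeasurable[mX.comap Y] (P[F | mX.comap Y]) := stronglyMeasurable_condExp
  obtain ⟨h, hh, hcomp⟩ := hsm.exists_eq_measurable_comp (f := Y)
  have hhm : Measurable h := hh.measurable
  have hcω : ∀ ω, (P[F | mX.comap Y]) ω = h (Y ω) := fun ω => congrFun hcomp ω
  have hbd : ∀ᵐ ω ∂P, |(P[F | mX.comap Y]) ω| ≤ 1 :=
    ae_bdd_abs_condExp_of_ae_bdd_abs (Filter.Eventually.of_forall hFb)
  -- clamp to [−1, 1]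
  let m : X → ℝ := fun x => max (-1) (min 1 (h x))
  have hmm : Measurable m := measurable_const.max (measurable_const.min hhm)
  have hmb : ∀ x, |m x| ≤ 1 := fun x => by
    change |max (-1) (min 1 (h x))| ≤ 1
    rw [abs_le]
    exact ⟨le_max_left _ _, max_le (by norm_num) (min_le_left _ _)⟩
  have hmY : ∀ᵐ ω ∂P, m (Y ω) = (P[F | mX.comap Y]) ω := by
    filter_upwards [hbd] with ω hω
    rw [hcω] at hω ⊢
    obtain ⟨h1, h2⟩ := abs_le.mp hω
    change max (-1) (min 1 (h (Y ω))) = h (Y ω)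
    rw [min_eq_right h2, max_eq_right h1]
  have hmsm : AEStronglyMeasurable m (P.map Y) := hmm.aestronglyMeasurable
  refine ⟨m, hmm, hmb, fun A hA => ?_, ?_⟩
  · have hsA : MeasurableSet[mX.comap Y] (Y ⁻¹' A) := ⟨A, hA, rfl⟩
    rw [setIntegral_map hA hmsm hY.aemeasurable, ← setIntegral_condExp hle hFi hsA]
    exact setIntegral_congr_ae (hle _ hsA) (hmY.mono fun ω hω _ => hω.symm)
  · rw [integral_map hY.aemeasurable hmsm, ← integral_condExp hle (f := F)]
    exact integral_congr_ae (hmY.mono fun ω hω => hω.symm)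

end CondMean

/-! ## §2 Scheme level: a CHAIN REALISATION of the Gibbs fields and of the laws `ν K` gives `DressingMeans` -/

section Realisation

variable {G : Type*} {O : Type*} [MeasurableSpace G] [GaugeGroup G] [HaarData G] [RegularGaugeGroup G]
  (S : TorusScheme G O) {X : Type*} [MeasurableSpace X]

/-- **Leaf (k4), scheme half: `∃ m, DressingMeans S ν m` from a chain realisation.**  Suppose that for every `K` one
probability space `(Ω K, P K)` carries a measurable copy `ι K` of run `K`'s Gibbs field (`(P K).map (ι K) =` the
scheme's Gibbs measure at step `K`) and a measurable endpoint `Y K` whose law is `ν K` — for Bałaban's scheme: the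
averaging-and-resampling chain started from the Wilson field, whose endpoint law is the normalised `(ℝT)^K ρ₀ dV`.  Then
the conditional means of the observable products given the endpoint are dressing means in the sense of NODE Q:
`S.expectAt K os = ∫ m K os dν_K`, `|m| ≤ 1`, measurable. [folklore] -/
theorem exists_dressingMeans_of_realisation (hβ : ∀ K, 0 ≤ S.β K) (hobs : ∀ K o, Measurable (S.obs K o))
    (h1 : ∀ K o U, |S.obs K o U| ≤ 1) {Ω : ℕ → Type*} [∀ K, MeasurableSpace (Ω K)] (P : ∀ K, Measure (Ω K))
    [∀ K, IsProbabilityMeasure (P K)] (ι : ∀ K, Ω K → GaugeField (S.P K) 0 G) (hι : ∀ K, Measurable (ι K))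
    (hιlaw : ∀ K, (P K).map (ι K) = T4GenFunBounds.gibbsMeasure (S.P K) (S.β K))
    (Y : ∀ K, Ω K → X) (hY : ∀ K, Measurable (Y K)) (ν : ℕ → Measure X) (hνlaw : ∀ K, (P K).map (Y K) = ν K) :
    ∃ m : ℕ → List O → X → ℝ, DressingMeans S ν m := by
  -- per (K, os): the dressing `F = (∏ obs) ∘ ι K` on `Ω K`
  have key : ∀ K os, ∃ m : X → ℝ, Measurable m ∧ (∀ x, |m x| ≤ 1) ∧
      S.expectAt K os = ∫ x, m x ∂(ν K) := by
    intro K os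
    have hFm : Measurable fun ω => T4GenFunBounds.prodObs S K os (ι K ω) :=
      (T4GenFunBounds.measurable_prodObs S hobs K os).comp (hι K)
    have hFb : ∀ ω, |T4GenFunBounds.prodObs S K os (ι K ω)| ≤ 1 := fun ω =>
      T4GenFunBounds.abs_prodObs_le_one S h1 K os (ι K ω)
    obtain ⟨m, hmm, hmb, -, hint⟩ := exists_condMean_factor (P K) (hY K) hFm hFb
    refine ⟨m, hmm, hmb, ?_⟩
    rw [T4GenFunBounds.expectAt_eq_integral_gibbs S hβ K os, ← hιlaw K,
      integral_map (hι K).aemeasurable (T4GenFunBounds.measurable_prodObs S hobs K os).aestronglyMeasurable, hint,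
      hνlaw K]
  choose m hm using key
  exact ⟨m, fun K os => hm K os⟩

end Realisation

end Summit.QuantumFields.BalabanUV.T4Continuum.NE7LawLevel

end
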